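import Literature.NumberTheory.Sieve.BombieriFriedlanderIwaniecDispersionS1Rest
import Literature.NumberTheory.Sieve.BombieriFriedlanderIwaniecTheorem1MainTermAvg
import HarnessLib

/-!
# Bombieri–Friedlander–Iwaniec 1986, Theorem 1: the errors of `𝒮₁` ((6.3)–(6.4), (6.11)–(6.12)), averaged

Topic `Literature/NumberTheory/Sieve`.  Part of the assembly of the proof of Theorem 1 of
E. Bombieri, J. B. Friedlander, H. Iwaniec, *Primes in arithmetic progressions to large moduli*,
Acta Math. 156 (1986), 203–251.  The files `…DispersionS1` and `…DispersionS1Rest` bound the two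
parts of `𝒮₁ = 𝒮₁ᶜ + 𝒮₁ⁿ` (main range `(n₁,n₂)=1, q₀ ≤ Q₀`, and the rest) by explicit un-averaged
sums; here they are averaged over the moduli with the weights of (A₃):

* `BFI.errS1_le` and **`BFI.norm_dS1c_sub_le_avg`** — (6.11)–(6.12) p. 221: for BFI's weight
  `f = bump M (M/2)`, a uniform frequency cut `H` and `8Q²R ≤ θ π M (H+1)`,
  `‖𝒮₁ᶜ − f̂(0)𝒳 − ℛ₁‖ ≤ (16C₀^BQx^{ε₁/4})² ‖β‖² ((2R+1)·3N·8K_jM(H+1)θʲ + (2R+1)(2N/R+1)·8π|a|MH²Q₀²/(Q⁴R²N))`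
  — the Poisson tails (superpolynomially small once `θ = x^{−ε₁}`) plus the phase error of (6.10),
  the latter using the congruence `n₁ ≡ n₂ (q₀r)` of the solvable systems (6.1)
  (`BFI.sum_congr_pairs_abs_le`);
* **`BFI.abs_dS1n_le_avg`** — (6.3)–(6.4) p. 220 averaged: the bound of `BFI.abs_dS1n_le` summed over
  `r ∼ R`, `q₁ ∼ Q` with logarithmic losses for the two Lemma-3 terms (saving `z⁻¹`, `Q₀⁻¹`) and the
  divisor bound for the short-progression terms (saving `P₀⁻¹`).

Everything here is PROVED; no named facts are introduced.

## References

* E. Bombieri, J. B. Friedlander, H. Iwaniec, Acta Math. 156 (1986), 203–251, §6 (6.3)–(6.4)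
  p. 220, (6.9)–(6.12) p. 221. [BombieriFriedlanderIwaniecActa1986]
-/

noncomputable section

open Finset Real
open scoped ArithmeticFunction.sigma

namespace Literature.NumberTheory.Sieve

namespace BFI

/-! ### Pairs in a common residue class -/

/-- **Pairs `n₁ ≡ n₂ (mod D)` weighted by `|β_{n₁}β_{n₂}|`**: for `D ≥ 1`, `N ≥ 0`,
`∑_{n₁,n₂∼N, n₁≡n₂ (D)} |β_{n₁}β_{n₂}| ≤ ‖β‖² (2N/D + 1)` (by `2|uv| ≤ u² + v²` and the class count
`#{n∼N : n ≡ c} ≤ 2N/D + 1`). [folklore] -/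
theorem sum_congr_pairs_abs_le {N : ℝ} (hN : 0 ≤ N) {D : ℕ} (hD : 0 < D) (β : ℕ → ℝ) :
    ∑ n₁ ∈ dyadic N, ∑ n₂ ∈ dyadic N,
        (if (n₁ : ZMod D) = (n₂ : ZMod D) then |β n₁| * |β n₂| else 0) ≤
      l2Sq N β * (2 * N / D + 1) := by
  have hcnt : ∀ n₁ : ℕ, (#((dyadic N).filter (fun n₂ : ℕ => (n₁ : ZMod D) = (n₂ : ZMod D))) : ℝ) ≤
      2 * N / D + 1 := by
    intro n₁
    have h := card_dyadic_class_le hN hD (n₁ : ZMod D)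
    rwa [Finset.filter_congr (fun n₂ _ => eq_comm)] at h
  -- `|uv| ≤ (u² + v²)/2`, then the two halves by symmetry
  have hhalf : ∀ (F : ℕ → ℕ → Prop) [∀ n₁ n₂, Decidable (F n₁ n₂)],
      (∀ n₁, (#((dyadic N).filter (fun n₂ => F n₁ n₂)) : ℝ) ≤ 2 * N / D + 1) →
      ∑ n₁ ∈ dyadic N, ∑ n₂ ∈ dyadic N, (if F n₁ n₂ then β n₁ ^ 2 / 2 else 0) ≤
        l2Sq N β * (2 * N / D + 1) / 2 := by
    intro F _ hF
    calc ∑ n₁ ∈ dyadic N, ∑ n₂ ∈ dyadic N, (if F n₁ n₂ then β n₁ ^ 2 / 2 else 0)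
        = ∑ n₁ ∈ dyadic N, (#((dyadic N).filter (fun n₂ => F n₁ n₂)) : ℝ) * (β n₁ ^ 2 / 2) := by
          refine Finset.sum_congr rfl fun n₁ _ => ?_
          rw [← Finset.sum_filter, Finset.sum_const, nsmul_eq_mul]
      _ ≤ ∑ n₁ ∈ dyadic N, (2 * N / D + 1) * (β n₁ ^ 2 / 2) :=
          Finset.sum_le_sum fun n₁ _ => mul_le_mul_of_nonneg_right (hF n₁) (by positivity)
      _ = l2Sq N β * (2 * N / D + 1) / 2 := by
          rw [← Finset.mul_sum, l2Sq, ← Finset.sum_div]; ring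
  have h1 := hhalf (fun n₁ n₂ => (n₁ : ZMod D) = (n₂ : ZMod D)) hcnt
  have h2 : ∑ n₁ ∈ dyadic N, ∑ n₂ ∈ dyadic N,
      (if (n₁ : ZMod D) = (n₂ : ZMod D) then β n₂ ^ 2 / 2 else 0) ≤
      l2Sq N β * (2 * N / D + 1) / 2 := by
    rw [Finset.sum_comm]
    have h := hhalf (fun n₂ n₁ => (n₁ : ZMod D) = (n₂ : ZMod D)) (fun n₂ => by
      have h := card_dyadic_class_le hN hD (n₂ : ZMod D)
      exact h)
    exact h
  calc ∑ n₁ ∈ dyadic N, ∑ n₂ ∈ dyadic N,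
        (if (n₁ : ZMod D) = (n₂ : ZMod D) then |β n₁| * |β n₂| else 0)
      ≤ ∑ n₁ ∈ dyadic N, ∑ n₂ ∈ dyadic N,
          ((if (n₁ : ZMod D) = (n₂ : ZMod D) then β n₁ ^ 2 / 2 else 0) +
            (if (n₁ : ZMod D) = (n₂ : ZMod D) then β n₂ ^ 2 / 2 else 0)) := by
        refine Finset.sum_le_sum fun n₁ _ => Finset.sum_le_sum fun n₂ _ => ?_
        split_ifs
        · nlinarith [sq_nonneg (|β n₁| - |β n₂|), sq_abs (β n₁), sq_abs (β n₂)]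
        · simp
    _ ≤ l2Sq N β * (2 * N / D + 1) / 2 + l2Sq N β * (2 * N / D + 1) / 2 := by
        simp only [Finset.sum_add_distrib]
        exact add_le_add h1 h2
    _ = l2Sq N β * (2 * N / D + 1) := by ring

/-! ### The error weight `errS1` of the main range, bounded uniformly -/

/-- **The Poisson tail and the phase error of one index of `𝒮₁ᶜ`** (BFI (6.9)–(6.12), p. 221), for
`f = bump M (M/2)`, `q₁, q₂ ∼ Q`, `r ∼ R`, `n₁ ∼ N` (`Q, R, N > 0`), `q₀ = (q₁,q₂) ≤ Q₀`, a uniform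
`H` and `8Q²R ≤ θ π M (H+1)` (so that `L/(2πY(H+1)) ≤ θ` for every `L = [q₁,q₂]r ≤ 8Q²R`), `j ≥ 1`:
`errS1 ≤ 8 K_j M (H+1) θʲ + 8π|a| M H² Q₀²/(Q⁴R²N)` (using `L ≥ Q²R/Q₀`, `n₁ > N`).
[cite: BombieriFriedlanderIwaniecActa1986, §6 (6.9)–(6.12) p. 221] -/
theorem errS1_le {a : ℤ} {M N Q R Q₀ θ : ℝ} (hM : 0 < M) (hN : 0 < N) (hQ : 0 < Q) (hR : 0 < R)
    (hQ₀ : 0 < Q₀) {j : ℕ} (hj : 1 ≤ j) (H : ℕ)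
    (hθ : 8 * Q ^ 2 * R ≤ θ * (π * M * ((H : ℝ) + 1))) {r q₁ q₂ n₁ : ℕ} (hr : r ∈ dyadic R)
    (hq₁ : q₁ ∈ dyadic Q) (hq₂ : q₂ ∈ dyadic Q) (hn₁ : n₁ ∈ dyadic N)
    (hg : (Nat.gcd q₁ q₂ : ℝ) ≤ Q₀) :
    errS1 a M (M / 2) j H r q₁ q₂ n₁ ≤
      8 * derivConst j * M * ((H : ℝ) + 1) * θ ^ j +
        8 * π * |(a : ℝ)| * M * (H : ℝ) ^ 2 * Q₀ ^ 2 / (Q ^ 4 * R ^ 2 * N) := by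
  have hY : 0 < M / 2 := by positivity
  obtain ⟨hr1, hr2⟩ := (mem_dyadic hR.le).1 hr
  obtain ⟨hq₁1, hq₁2⟩ := (mem_dyadic hQ.le).1 hq₁
  obtain ⟨hq₂1, hq₂2⟩ := (mem_dyadic hQ.le).1 hq₂
  obtain ⟨hn₁1, _⟩ := (mem_dyadic hN.le).1 hn₁
  have hr0 := pos_of_mem_dyadic hR.le hr
  have hq₁0 := pos_of_mem_dyadic hQ.le hq₁
  have hq₂0 := pos_of_mem_dyadic hQ.le hq₂
  have hgpos : 0 < Nat.gcd q₁ q₂ := Nat.gcd_pos_of_pos_left _ hq₁0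
  have hg0 : (0 : ℝ) < (Nat.gcd q₁ q₂ : ℝ) := by exact_mod_cast hgpos
  have hLpos := lmod_pos hr0 hq₁0 hq₂0
  have hL0 : (0 : ℝ) < (lmod r q₁ q₂ : ℝ) := by exact_mod_cast hLpos
  have hL1 : (1 : ℝ) ≤ (lmod r q₁ q₂ : ℝ) := by exact_mod_cast hLpos
  -- `L g = q₁ q₂ r`
  have hLg : (lmod r q₁ q₂ : ℝ) * (Nat.gcd q₁ q₂ : ℝ) = (q₁ : ℝ) * q₂ * r := by
    exact_mod_cast lmod_mul_gcd r q₁ q₂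
  -- `L ≤ 8Q²R`
  have hLle : (lmod r q₁ q₂ : ℝ) ≤ 8 * Q ^ 2 * R := by
    have h1 : (lmod r q₁ q₂ : ℝ) ≤ (lmod r q₁ q₂ : ℝ) * (Nat.gcd q₁ q₂ : ℝ) := by
      have : (1 : ℝ) ≤ (Nat.gcd q₁ q₂ : ℝ) := by exact_mod_cast hgpos
      exact le_mul_of_one_le_right hL0.le this
    rw [hLg] at h1
    refine h1.trans ?_
    calc (q₁ : ℝ) * q₂ * r ≤ (2 * Q) * (2 * Q) * (2 * R) := by
          refine mul_le_mul (mul_le_mul hq₁2 hq₂2 (by positivity) (by positivity)) hr2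
            (by positivity) (by positivity)
      _ = 8 * Q ^ 2 * R := by ring
  -- `L ≥ Q²R/Q₀`
  have hLge : Q ^ 2 * R / Q₀ ≤ (lmod r q₁ q₂ : ℝ) := by
    rw [div_le_iff₀ hQ₀]
    calc Q ^ 2 * R ≤ (q₁ : ℝ) * q₂ * r := by
          rw [sq]
          exact mul_le_mul (mul_le_mul hq₁1.le hq₂1.le hQ.le (by positivity)) hr1.le hR.le
            (by positivity)
      _ = (lmod r q₁ q₂ : ℝ) * (Nat.gcd q₁ q₂ : ℝ) := hLg.symm
      _ ≤ (lmod r q₁ q₂ : ℝ) * Q₀ := mul_le_mul_of_nonneg_left hg hL0.le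
  unfold errS1
  refine add_le_add ?_ ?_
  · -- the Poisson tail
    have hθ' : ((lmod r q₁ q₂ : ℕ) : ℝ) / (2 * π * (M / 2) * ((H : ℝ) + 1)) ≤ θ := by
      rw [div_le_iff₀ (by positivity)]
      calc ((lmod r q₁ q₂ : ℕ) : ℝ) ≤ 8 * Q ^ 2 * R := hLle
        _ ≤ θ * (π * M * ((H : ℝ) + 1)) := hθ
        _ = θ * (2 * π * (M / 2) * ((H : ℝ) + 1)) := by ring
    have htb := tailBound_le_of hY hj hθ'
    have htb0 := tailBound_nonneg hY j (lmod r q₁ q₂) H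
    have hinv : ((lmod r q₁ q₂ : ℕ) : ℝ)⁻¹ ≤ 1 := inv_le_one_of_one_le₀ hL1
    calc ((lmod r q₁ q₂ : ℕ) : ℝ)⁻¹ * tailBound (M / 2) j (lmod r q₁ q₂) H
        ≤ 1 * (16 * derivConst j * (M / 2 * ((H : ℝ) + 1)) * θ ^ j) :=
          mul_le_mul hinv htb htb0 zero_le_one
      _ = 8 * derivConst j * M * ((H : ℝ) + 1) * θ ^ j := by ring
  · -- the phase error
    have hn₁0 : (0 : ℝ) < n₁ := hN.trans hn₁1
    have e : ((lmod r q₁ q₂ : ℕ) : ℝ)⁻¹ * (2 * (M + 2 * (M / 2))) *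
        (2 * π * (|(a : ℝ)| * (H : ℝ) ^ 2 / ((lmod r q₁ q₂ : ℝ) * n₁))) =
        8 * π * |(a : ℝ)| * M * (H : ℝ) ^ 2 / ((lmod r q₁ q₂ : ℝ) ^ 2 * n₁) := by
      field_simp
      ring
    rw [e]
    have hQR : 0 < Q ^ 2 * R / Q₀ := by positivity
    have hden : (Q ^ 2 * R / Q₀) ^ 2 * N ≤ (lmod r q₁ q₂ : ℝ) ^ 2 * n₁ :=
      mul_le_mul (pow_le_pow_left₀ hQR.le hLge 2) hn₁1.le hN.le (by positivity)
    calc 8 * π * |(a : ℝ)| * M * (H : ℝ) ^ 2 / ((lmod r q₁ q₂ : ℝ) ^ 2 * n₁)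
        ≤ 8 * π * |(a : ℝ)| * M * (H : ℝ) ^ 2 / ((Q ^ 2 * R / Q₀) ^ 2 * N) :=
          div_le_div_of_nonneg_left (by positivity) (by positivity) hden
      _ = 8 * π * |(a : ℝ)| * M * (H : ℝ) ^ 2 * Q₀ ^ 2 / (Q ^ 4 * R ^ 2 * N) := by
          field_simp

/-! ### `𝒮₁ᶜ − f̂(0)𝒳 − ℛ₁` averaged -/

open Classical in
/-- The per-index majorant of the un-averaged bound for `𝒮₁ᶜ`: on the main, solvable range the
weight `|γγββ| errS1` is at most `|γ₁||γ₂|(|β₁||β₂| T + [n₁ ≡ n₂ (q₀r)] |β₁||β₂| P)` whenever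
`errS1 ≤ T + P` there (`T, P ≥ 0`). [folklore] -/
theorem dS1c_index_le {a : ℤ} {M Y Q₀ R Q T P : ℝ} (hR : 0 ≤ R) (hQ : 0 ≤ Q) (hT : 0 ≤ T)
    (hP : 0 ≤ P) (β γ : ℕ → ℝ) {j H : ℕ} {r q₁ q₂ n₁ n₂ : ℕ} (hr : r ∈ dyadic R)
    (hq₁ : q₁ ∈ dyadic Q) (hq₂ : q₂ ∈ dyadic Q)
    (herr : (Nat.gcd q₁ q₂ : ℝ) ≤ Q₀ → errS1 a M Y j H r q₁ q₂ n₁ ≤ T + P) :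
    (if Main Q₀ q₁ q₂ n₁ n₂ ∧ Solvable a r q₁ q₂ n₁ n₂ then
        |γ q₁ * γ q₂ * β n₁ * β n₂| * errS1 a M Y j H r q₁ q₂ n₁ else 0) ≤
      |γ q₁| * |γ q₂| * (|β n₁| * |β n₂| * T) +
        |γ q₁| * |γ q₂| *
          ((if (n₁ : ZMod (gmod r q₁ q₂)) = (n₂ : ZMod (gmod r q₁ q₂)) then |β n₁| * |β n₂|
            else 0) * P) := by
  have hr0 := pos_of_mem_dyadic hR hr
  have hq₁0 := pos_of_mem_dyadic hQ hq₁
  have hq₂0 := pos_of_mem_dyadic hQ hq₂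
  by_cases hc : Main Q₀ q₁ q₂ n₁ n₂ ∧ Solvable a r q₁ q₂ n₁ n₂
  · rw [if_pos hc]
    obtain ⟨⟨_, hg⟩, hsol⟩ := hc
    have hcong : (n₁ : ZMod (gmod r q₁ q₂)) = (n₂ : ZMod (gmod r q₁ q₂)) :=
      ((solvable_iff hr0 hq₁0 hq₂0 n₁ n₂).1 hsol).2.2.2
    rw [if_pos hcong, abs_mul, abs_mul, abs_mul]
    calc |γ q₁| * |γ q₂| * |β n₁| * |β n₂| * errS1 a M Y j H r q₁ q₂ n₁
        ≤ |γ q₁| * |γ q₂| * |β n₁| * |β n₂| * (T + P) :=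
          mul_le_mul_of_nonneg_left (herr hg) (by positivity)
      _ = _ := by ring
  · rw [if_neg hc]
    have hite : 0 ≤ (if (n₁ : ZMod (gmod r q₁ q₂)) = (n₂ : ZMod (gmod r q₁ q₂)) then
        |β n₁| * |β n₂| else 0) := by
      split_ifs <;> positivity
    exact add_nonneg (by positivity) (mul_nonneg (by positivity) (mul_nonneg hite hP))

open Classical in
/-- **`𝒮₁ᶜ = f̂(0)𝒳 + ℛ₁ + O(…)` with the error averaged** (BFI (6.11)–(6.12), p. 221: "we obtain
`𝒮₁ = f̂(0)𝒳 + ℛ₁ + O(‖β‖²xR⁻¹ℒ^{−A})` (6.11) provided `NQ²R < x^{2−ε}` (6.12)"), in explicit form: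
for `f = bump M (M/2)` (`M > 0`), `N ≥ 1`, `1/2 ≤ Q ≤ 2x`, `R ≥ 1/2`, `x ≥ 1`, `Q₀ > 0`, a uniform
frequency cut `H`, `j ≥ 2`, `θ ≥ 0` with `8Q²R ≤ θπM(H+1)`, `|γ_q| ≤ τ(q)^B` and the divisor bound
(`νB ≤ ε₁/4 ≤ 1`):
`‖𝒮₁ᶜ − α̂₀𝒳 − ℛ₁‖ ≤ (16C₀^BQx^{ε₁/4})² ‖β‖² (2R+1) (3N · 8K_jM(H+1)θʲ + (2N/R+1) · 8π|a|MH²Q₀²/(Q⁴R²N))`.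
[cite: BombieriFriedlanderIwaniecActa1986, §6 (6.9)–(6.12) p. 221] -/
theorem norm_dS1c_sub_le_avg {C₀ ν : ℝ} (hC₀ : 1 ≤ C₀) (hν : 0 ≤ ν)
    (hτ : ∀ n : ℕ, n ≠ 0 → ((σ 0 n : ℕ) : ℝ) ≤ C₀ * (n : ℝ) ^ ν) {a : ℤ}
    {M N Q R Q₀ x ε₁ B θ : ℝ} (hM : 0 < M) (hN : 1 ≤ N) (hQ : 1 / 2 ≤ Q) (hR : 1 / 2 ≤ R)
    (hQx : Q ≤ 2 * x) (hx : 1 ≤ x) (hB : 0 ≤ B) (hνB : ν * B ≤ ε₁ / 4) (hε₁ : ε₁ ≤ 4)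
    (hQ₀ : 0 < Q₀) {γ : ℕ → ℝ} (hγ : ∀ q, |γ q| ≤ (σ 0 q : ℝ) ^ B) (β : ℕ → ℝ) (H : ℕ)
    {j : ℕ} (hj : 2 ≤ j) (hθ0 : 0 ≤ θ) (hθ : 8 * Q ^ 2 * R ≤ θ * (π * M * ((H : ℝ) + 1))) :
    ‖(dS1c a (mRange M (M / 2)) N Q R Q₀ (fun m => bump M (M / 2) m) β γ : ℂ) -
        alphaHat M (M / 2) * (calX a N Q R Q₀ β γ : ℂ) - calR1 a M (M / 2) N Q R Q₀ β γ H‖ ≤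
      (16 * C₀ ^ B * Q * x ^ (ε₁ / 4)) ^ 2 * l2Sq N β * (2 * R + 1) *
        (3 * N * (8 * derivConst j * M * ((H : ℝ) + 1) * θ ^ j) +
          (2 * N / R + 1) * (8 * π * |(a : ℝ)| * M * (H : ℝ) ^ 2 * Q₀ ^ 2 / (Q ^ 4 * R ^ 2 * N))) := by
  have hY : 0 < M / 2 := by positivity
  have hYM : M / 2 ≤ M := by linarith
  have hQ0 : 0 < Q := by linarith
  have hR0 : 0 < R := by linarith
  have hN0 : 0 < N := by linarith
  have hl := l2Sq_nonneg N β
  have hKj := one_le_derivConst j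
  have hj1 : 1 ≤ j := le_trans (by norm_num) hj
  set T : ℝ := 8 * derivConst j * M * ((H : ℝ) + 1) * θ ^ j with hTdef
  set P : ℝ := 8 * π * |(a : ℝ)| * M * (H : ℝ) ^ 2 * Q₀ ^ 2 / (Q ^ 4 * R ^ 2 * N) with hPdef
  have hT0 : 0 ≤ T := by positivity
  have hP0 : 0 ≤ P := by positivity
  refine (norm_dS1c_sub_calX_sub_calR1_le hY hYM hN0.le hQ0.le hR0.le Q₀ β γ H hj).trans ?_
  -- per index
  have hidx : ∀ r ∈ dyadic R, ∀ q₁ ∈ dyadic Q, ∀ q₂ ∈ dyadic Q, ∀ n₁ ∈ dyadic N, ∀ n₂ ∈ dyadic N,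
      (if Main Q₀ q₁ q₂ n₁ n₂ ∧ Solvable a r q₁ q₂ n₁ n₂ then
          |γ q₁ * γ q₂ * β n₁ * β n₂| * errS1 a M (M / 2) j H r q₁ q₂ n₁ else 0) ≤
        |γ q₁| * |γ q₂| * (|β n₁| * |β n₂| * T) +
          |γ q₁| * |γ q₂| *
            ((if (n₁ : ZMod (gmod r q₁ q₂)) = (n₂ : ZMod (gmod r q₁ q₂)) then |β n₁| * |β n₂|
              else 0) * P) := by
    intro r hr q₁ hq₁ q₂ hq₂ n₁ hn₁ n₂ _
    exact dS1c_index_le hR0.le hQ0.le hT0 hP0 β γ hr hq₁ hq₂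
      (fun hg => errS1_le hM hN0 hQ0 hR0 hQ₀ hj1 H hθ hr hq₁ hq₂ hn₁ hg)
  -- the inner double sums over `n₁, n₂`
  have hS := sum_abs_le_sqrt_mul hN β
  have hSβ0 : 0 ≤ ∑ n ∈ dyadic N, |β n| := Finset.sum_nonneg fun _ _ => abs_nonneg _
  have hS2 : (∑ n ∈ dyadic N, |β n|) ^ 2 ≤ 3 * N * l2Sq N β := by
    calc (∑ n ∈ dyadic N, |β n|) ^ 2 ≤ (Real.sqrt (3 * N) * Real.sqrt (l2Sq N β)) ^ 2 :=
          pow_le_pow_left₀ hSβ0 hS 2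
      _ = 3 * N * l2Sq N β := by rw [mul_pow, Real.sq_sqrt (by linarith), Real.sq_sqrt hl]
  set W : ℝ := 3 * N * l2Sq N β * T + l2Sq N β * (2 * N / R + 1) * P with hWdef
  have hinner : ∀ r ∈ dyadic R, ∀ q₁ ∈ dyadic Q, ∀ q₂ ∈ dyadic Q,
      ∑ n₁ ∈ dyadic N, ∑ n₂ ∈ dyadic N,
        (if Main Q₀ q₁ q₂ n₁ n₂ ∧ Solvable a r q₁ q₂ n₁ n₂ then
          |γ q₁ * γ q₂ * β n₁ * β n₂| * errS1 a M (M / 2) j H r q₁ q₂ n₁ else 0) ≤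
        |γ q₁| * |γ q₂| * W := by
    intro r hr q₁ hq₁ q₂ hq₂
    have hr0 := pos_of_mem_dyadic hR0.le hr
    have hr' := (mem_dyadic hR0.le).1 hr
    have hq₁0 := pos_of_mem_dyadic hQ0.le hq₁
    have hG : 0 < gmod r q₁ q₂ := gmod_pos hr0 hq₁0
    -- the congruence count at modulus `q₀ r ≥ R`
    have hpairs := sum_congr_pairs_abs_le hN0.le hG β
    have hGR : 2 * N / (gmod r q₁ q₂ : ℕ) + 1 ≤ 2 * N / R + 1 := by
      have hg1 : (1 : ℝ) ≤ (Nat.gcd q₁ q₂ : ℝ) := by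
        exact_mod_cast Nat.gcd_pos_of_pos_left _ hq₁0
      have hGR' : R ≤ ((gmod r q₁ q₂ : ℕ) : ℝ) := by
        simp only [gmod, Nat.cast_mul]
        calc R ≤ 1 * (r : ℝ) := by rw [one_mul]; exact hr'.1.le
          _ ≤ (Nat.gcd q₁ q₂ : ℝ) * r := mul_le_mul_of_nonneg_right hg1 (by positivity)
      have := div_le_div_of_nonneg_left (by linarith : 0 ≤ 2 * N) hR0 hGR'
      linarith
    calc ∑ n₁ ∈ dyadic N, ∑ n₂ ∈ dyadic N,
          (if Main Q₀ q₁ q₂ n₁ n₂ ∧ Solvable a r q₁ q₂ n₁ n₂ then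
            |γ q₁ * γ q₂ * β n₁ * β n₂| * errS1 a M (M / 2) j H r q₁ q₂ n₁ else 0)
        ≤ ∑ n₁ ∈ dyadic N, ∑ n₂ ∈ dyadic N,
            (|γ q₁| * |γ q₂| * (|β n₁| * |β n₂| * T) +
              |γ q₁| * |γ q₂| *
                ((if (n₁ : ZMod (gmod r q₁ q₂)) = (n₂ : ZMod (gmod r q₁ q₂)) then
                  |β n₁| * |β n₂| else 0) * P)) :=
          Finset.sum_le_sum fun n₁ hn₁ => Finset.sum_le_sum fun n₂ hn₂ =>
            hidx r hr q₁ hq₁ q₂ hq₂ n₁ hn₁ n₂ hn₂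
      _ = |γ q₁| * |γ q₂| * (T * ((∑ n ∈ dyadic N, |β n|) * ∑ n ∈ dyadic N, |β n|) +
            P * ∑ n₁ ∈ dyadic N, ∑ n₂ ∈ dyadic N,
              (if (n₁ : ZMod (gmod r q₁ q₂)) = (n₂ : ZMod (gmod r q₁ q₂)) then
                |β n₁| * |β n₂| else 0)) := by
          rw [Finset.sum_mul_sum]
          simp only [Finset.sum_add_distrib, ← Finset.mul_sum, ← Finset.sum_mul]
          ring
      _ ≤ |γ q₁| * |γ q₂| * (T * (3 * N * l2Sq N β) + P * (l2Sq N β * (2 * N / R + 1))) := by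
          rw [← sq]
          have h2 : ∑ n₁ ∈ dyadic N, ∑ n₂ ∈ dyadic N,
              (if (n₁ : ZMod (gmod r q₁ q₂)) = (n₂ : ZMod (gmod r q₁ q₂)) then
                |β n₁| * |β n₂| else 0) ≤ l2Sq N β * (2 * N / R + 1) :=
            hpairs.trans (mul_le_mul_of_nonneg_left hGR hl)
          gcongr
      _ = |γ q₁| * |γ q₂| * W := by rw [hWdef]; ring
  -- the outer sums over `r, q₁, q₂`
  have hνB' : ν * B ≤ ε₁ / 4 := hνB
  have hSγ : ∑ q ∈ dyadic Q, |γ q| ≤ 16 * C₀ ^ B * Q * x ^ (ε₁ / 4) := by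
    refine le_trans (Finset.sum_le_sum fun q _ => hγ q) ?_
    exact sum_dyadic_sigma_rpow_le_x hC₀ hν hτ hQ hQx hx hB hνB' hε₁
  have hSγ0 : 0 ≤ ∑ q ∈ dyadic Q, |γ q| := Finset.sum_nonneg fun _ _ => abs_nonneg _
  have hW0 : 0 ≤ W := by positivity
  have hcard := card_dyadic_le hR0.le
  calc ∑ r ∈ dyadic R, ∑ q₁ ∈ dyadic Q, ∑ q₂ ∈ dyadic Q, ∑ n₁ ∈ dyadic N, ∑ n₂ ∈ dyadic N,
        (if Main Q₀ q₁ q₂ n₁ n₂ ∧ Solvable a r q₁ q₂ n₁ n₂ then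
          |γ q₁ * γ q₂ * β n₁ * β n₂| * errS1 a M (M / 2) j H r q₁ q₂ n₁ else 0)
      ≤ ∑ r ∈ dyadic R, ∑ q₁ ∈ dyadic Q, ∑ q₂ ∈ dyadic Q, |γ q₁| * |γ q₂| * W :=
        Finset.sum_le_sum fun r hr => Finset.sum_le_sum fun q₁ hq₁ =>
          Finset.sum_le_sum fun q₂ hq₂ => hinner r hr q₁ hq₁ q₂ hq₂
    _ = (#(dyadic R) : ℝ) * ((∑ q ∈ dyadic Q, |γ q|) * (∑ q ∈ dyadic Q, |γ q|)) * W := by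
        rw [Finset.sum_mul_sum, Finset.sum_const, nsmul_eq_mul]
        simp only [← Finset.sum_mul]
        ring
    _ ≤ (2 * R + 1) * ((16 * C₀ ^ B * Q * x ^ (ε₁ / 4)) * (16 * C₀ ^ B * Q * x ^ (ε₁ / 4))) * W := by
        gcongr
    _ = _ := by rw [hWdef, hTdef, hPdef]; ring

/-! ### `𝒮₁ⁿ` averaged (BFI (6.3)–(6.4)) -/

/-- `t^a t^b ≤ t^k` for `t ≥ 1` and `a + b ≤ k`. [folklore] -/
theorem rpow_mul_rpow_le_pow {t : ℝ} (ht : 1 ≤ t) {a b : ℝ} {k : ℕ} (h : a + b ≤ k) :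
    t ^ a * t ^ b ≤ t ^ k := by
  have ht0 : 0 < t := by linarith
  rw [← Real.rpow_add ht0, ← Real.rpow_natCast]
  exact Real.rpow_le_rpow_of_exponent_le ht h

/-- `t · t^a t^b t^c ≤ t^k` for `t ≥ 1` and `1 + a + b + c ≤ k`. [folklore] -/
theorem mul_rpow_three_le_pow {t : ℝ} (ht : 1 ≤ t) {a b c : ℝ} {k : ℕ}
    (h : 1 + a + b + c ≤ k) : t * t ^ a * t ^ b * t ^ c ≤ t ^ k := by
  have ht0 : 0 < t := by linarith
  have e : t * t ^ a * t ^ b * t ^ c = t ^ (1 + a + b + c) := by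
    rw [Real.rpow_add ht0, Real.rpow_add ht0, Real.rpow_add ht0, Real.rpow_one]
  rw [e, ← Real.rpow_natCast]
  exact Real.rpow_le_rpow_of_exponent_le ht h

/-- `t^a · t = t^{a+1}`-type bound: `t · t^B ≤ t^{B+1}` as real powers (`t ≥ 1`). [folklore] -/
theorem mul_rpow_eq_rpow_add_one {t : ℝ} (ht : 0 < t) (B : ℝ) : t * t ^ B = t ^ (B + 1) := by
  rw [Real.rpow_add_one ht.ne', mul_comm]

/-- **One term of the bound of `BFI.abs_dS1n_le`, simplified** (`Y = M/2`, `r ∼ R`, `q₁ ∼ Q`):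
with `ℓ = log(5M/2)`, `K_A = ω₀C₃C₄·5MN·(2lg)^{B₃}ℓ^{B₄}/z`, `K_C = C₃C₄·5MN·lg^{B₃}ℓ^{B₄}/Q₀`,
`T_c = T(2N/(P₀R)+1)` and natural exponents `k₁ ≥ B+B₄`, `k₂ ≥ B₃+B₄`, `k₃ ≥ 1+B+B₃+B₄`, the term is
`≤ ‖β‖² (K_A (τ(q₁)^{k₁}/q₁)(τ(r)^{k₂}/(Rr)) + K_C (τ(q₁)^{k₃}/q₁)(τ(r)^{k₂}/(Rr))
   + (ω₀ τ(q₁)^B + τ(q₁)^{B+1}) T_c ((5M/2)(1/q₁)(1/r) + 1))`.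
[cite: BombieriFriedlanderIwaniecActa1986, §6 (6.3)–(6.4) p. 220] -/
theorem dS1n_term_le {M N Q R Q₀ B z C₃ B₃ C₄ B₄ P₀ T lg ω₀ : ℝ} (hM1 : 1 ≤ M) (hN : 0 ≤ N)
    (hQ : 0 < Q) (hR : 0 < R) (hQ₀ : 0 < Q₀) (hz : 0 < z) (hC₃ : 0 ≤ C₃)
    (hC₄ : 0 ≤ C₄) (hB₄ : 0 ≤ B₄) (hP₀ : 0 < P₀) (hT : 0 ≤ T) (hlg : 0 ≤ lg) (hω₀ : 0 ≤ ω₀)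
    {γ : ℕ → ℝ} (hγ : ∀ q, |γ q| ≤ (σ 0 q : ℝ) ^ B) (β : ℕ → ℝ) {k₁ k₂ k₃ : ℕ}
    (hk₁ : B + B₄ ≤ k₁) (hk₂ : B₃ + B₄ ≤ k₂) (hk₃ : 1 + B + B₃ + B₄ ≤ k₃)
    {r q₁ : ℕ} (hr : r ∈ dyadic R) (hq₁ : q₁ ∈ dyadic Q) :
    |γ q₁| * l2Sq N β *
        (ω₀ * (C₃ * (2 * N / r) * (2 * (σ 0 r : ℝ) * lg) ^ B₃ / z *
            (C₄ * ((2 * M + M / 2) / ((q₁ * r : ℕ) : ℝ)) *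
              ((σ 0 (q₁ * r) : ℝ) * Real.log (2 * M + M / 2)) ^ B₄) +
            T * (2 * N / (P₀ * R) + 1) * ((2 * M + M / 2) / ((q₁ * r : ℕ) : ℝ) + 1)) +
          (σ 0 q₁ : ℝ) * (C₃ * (2 * N / (Q₀ * r)) * ((σ 0 q₁ : ℝ) * (σ 0 r : ℝ) * lg) ^ B₃ *
            (C₄ * ((2 * M + M / 2) / ((q₁ * r : ℕ) : ℝ)) *
              ((σ 0 (q₁ * r) : ℝ) * Real.log (2 * M + M / 2)) ^ B₄) +
            T * (2 * N / (P₀ * R) + 1) * ((2 * M + M / 2) / ((q₁ * r : ℕ) : ℝ) + 1))) ≤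
      l2Sq N β *
        ((ω₀ * C₃ * C₄ * (5 * M * N) * (2 * lg) ^ B₃ * Real.log (2 * M + M / 2) ^ B₄ / z) *
            ((σ 0 q₁ : ℝ) ^ k₁ / q₁) * ((σ 0 r : ℝ) ^ k₂ / (R * r)) +
          (C₃ * C₄ * (5 * M * N) * lg ^ B₃ * Real.log (2 * M + M / 2) ^ B₄ / Q₀) *
            ((σ 0 q₁ : ℝ) ^ k₃ / q₁) * ((σ 0 r : ℝ) ^ k₂ / (R * r)) +
          (ω₀ * (σ 0 q₁ : ℝ) ^ B + (σ 0 q₁ : ℝ) ^ (B + 1)) * (T * (2 * N / (P₀ * R) + 1)) *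
            (5 * M / 2 * (1 / (q₁ : ℝ)) * (1 / (r : ℝ)) + 1)) := by
  obtain ⟨hr1, hr2⟩ := (mem_dyadic hR.le).1 hr
  have hr0 := pos_of_mem_dyadic hR.le hr
  have hq₁0 := pos_of_mem_dyadic hQ.le hq₁
  have hr0' : (0 : ℝ) < r := by exact_mod_cast hr0
  have hq₁0' : (0 : ℝ) < q₁ := by exact_mod_cast hq₁0
  have hτ₁ : (1 : ℝ) ≤ (σ 0 q₁ : ℝ) := by exact_mod_cast one_le_sigma_zero hq₁0.ne'
  have hτr : (1 : ℝ) ≤ (σ 0 r : ℝ) := by exact_mod_cast one_le_sigma_zero hr0.ne'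
  have hτ₁0 : (0 : ℝ) < (σ 0 q₁ : ℝ) := by linarith
  have hτr0 : (0 : ℝ) < (σ 0 r : ℝ) := by linarith
  have hl := l2Sq_nonneg N β
  have hγ₁ := hγ q₁
  set ℓ : ℝ := Real.log (2 * M + M / 2) with hℓ
  have hℓ0 : 0 ≤ ℓ := Real.log_nonneg (by linarith)
  set Tc : ℝ := T * (2 * N / (P₀ * R) + 1) with hTc
  have hTc0 : 0 ≤ Tc := by positivity
  have hk : ((q₁ * r : ℕ) : ℝ) = (q₁ : ℝ) * r := by push_cast; ring
  rw [hk]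
  -- the divisor factor of `L₄`
  have hL4 : ((σ 0 (q₁ * r) : ℝ) * ℓ) ^ B₄ ≤ (σ 0 q₁ : ℝ) ^ B₄ * (σ 0 r : ℝ) ^ B₄ * ℓ ^ B₄ := by
    have h1 : (σ 0 (q₁ * r) : ℝ) * ℓ ≤ (σ 0 q₁ : ℝ) * (σ 0 r : ℝ) * ℓ :=
      mul_le_mul_of_nonneg_right (by exact_mod_cast sigma_zero_mul_le q₁ r) hℓ0
    calc ((σ 0 (q₁ * r) : ℝ) * ℓ) ^ B₄ ≤ ((σ 0 q₁ : ℝ) * (σ 0 r : ℝ) * ℓ) ^ B₄ :=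
          Real.rpow_le_rpow (by positivity) h1 hB₄
      _ = (σ 0 q₁ : ℝ) ^ B₄ * (σ 0 r : ℝ) ^ B₄ * ℓ ^ B₄ := by
          rw [Real.mul_rpow (by positivity) hℓ0, Real.mul_rpow hτ₁0.le hτr0.le]
  have hA3 : (2 * (σ 0 r : ℝ) * lg) ^ B₃ = (2 * lg) ^ B₃ * (σ 0 r : ℝ) ^ B₃ := by
    rw [show 2 * (σ 0 r : ℝ) * lg = (2 * lg) * (σ 0 r : ℝ) by ring,
      Real.mul_rpow (by positivity) hτr0.le]
  have hC3 : ((σ 0 q₁ : ℝ) * (σ 0 r : ℝ) * lg) ^ B₃ =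
      (σ 0 q₁ : ℝ) ^ B₃ * (σ 0 r : ℝ) ^ B₃ * lg ^ B₃ := by
    rw [Real.mul_rpow (by positivity) hlg, Real.mul_rpow hτ₁0.le hτr0.le]
  -- the four products, bounded in `rpow` form
  set L4b : ℝ := C₄ * ((2 * M + M / 2) / ((q₁ : ℝ) * r)) *
    ((σ 0 q₁ : ℝ) ^ B₄ * (σ 0 r : ℝ) ^ B₄ * ℓ ^ B₄) with hL4b
  have hL4le : C₄ * ((2 * M + M / 2) / ((q₁ : ℝ) * r)) * ((σ 0 (q₁ * r) : ℝ) * ℓ) ^ B₄ ≤ L4b :=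
    mul_le_mul_of_nonneg_left hL4 (by positivity)
  have hL40 : 0 ≤ C₄ * ((2 * M + M / 2) / ((q₁ : ℝ) * r)) * ((σ 0 (q₁ * r) : ℝ) * ℓ) ^ B₄ := by
    positivity
  have hαn0 : 0 ≤ C₃ * (2 * N / r) * (2 * (σ 0 r : ℝ) * lg) ^ B₃ / z := by positivity
  have hαq0 : 0 ≤ C₃ * (2 * N / (Q₀ * r)) * ((σ 0 q₁ : ℝ) * (σ 0 r : ℝ) * lg) ^ B₃ := by
    positivity
  have hE10 : 0 ≤ (2 * M + M / 2) / ((q₁ : ℝ) * r) + 1 := by positivity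
  -- Step 1: replace `|γ|` by `τ^B` and `L₄` by `L4b`
  have hstep1 : |γ q₁| * l2Sq N β *
      (ω₀ * (C₃ * (2 * N / r) * (2 * (σ 0 r : ℝ) * lg) ^ B₃ / z *
          (C₄ * ((2 * M + M / 2) / ((q₁ : ℝ) * r)) * ((σ 0 (q₁ * r) : ℝ) * ℓ) ^ B₄) +
          Tc * ((2 * M + M / 2) / ((q₁ : ℝ) * r) + 1)) +
        (σ 0 q₁ : ℝ) * (C₃ * (2 * N / (Q₀ * r)) * ((σ 0 q₁ : ℝ) * (σ 0 r : ℝ) * lg) ^ B₃ *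
          (C₄ * ((2 * M + M / 2) / ((q₁ : ℝ) * r)) * ((σ 0 (q₁ * r) : ℝ) * ℓ) ^ B₄) +
          Tc * ((2 * M + M / 2) / ((q₁ : ℝ) * r) + 1))) ≤
      (σ 0 q₁ : ℝ) ^ B * l2Sq N β *
      (ω₀ * (C₃ * (2 * N / r) * (2 * (σ 0 r : ℝ) * lg) ^ B₃ / z * L4b +
          Tc * ((2 * M + M / 2) / ((q₁ : ℝ) * r) + 1)) +
        (σ 0 q₁ : ℝ) * (C₃ * (2 * N / (Q₀ * r)) * ((σ 0 q₁ : ℝ) * (σ 0 r : ℝ) * lg) ^ B₃ * L4b +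
          Tc * ((2 * M + M / 2) / ((q₁ : ℝ) * r) + 1))) := by
    gcongr
  refine hstep1.trans ?_
  rw [hA3, hC3]
  · -- Step 2: regroup and relax the divisor powers
    have hP1 : (σ 0 q₁ : ℝ) ^ B * (σ 0 q₁ : ℝ) ^ B₄ ≤ (σ 0 q₁ : ℝ) ^ k₁ :=
      rpow_mul_rpow_le_pow hτ₁ hk₁
    have hP2 : (σ 0 r : ℝ) ^ B₃ * (σ 0 r : ℝ) ^ B₄ ≤ (σ 0 r : ℝ) ^ k₂ :=
      rpow_mul_rpow_le_pow hτr hk₂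
    have hP3 : (σ 0 q₁ : ℝ) * (σ 0 q₁ : ℝ) ^ B * (σ 0 q₁ : ℝ) ^ B₃ * (σ 0 q₁ : ℝ) ^ B₄ ≤
        (σ 0 q₁ : ℝ) ^ k₃ := mul_rpow_three_le_pow hτ₁ hk₃
    have hP4 : (σ 0 q₁ : ℝ) * (σ 0 q₁ : ℝ) ^ B = (σ 0 q₁ : ℝ) ^ (B + 1) :=
      mul_rpow_eq_rpow_add_one hτ₁0 B
    have hrr : 1 / ((r : ℝ) * r) ≤ 1 / (R * r) :=
      one_div_le_one_div_of_le (by positivity) (mul_le_mul_of_nonneg_right hr1.le hr0'.le)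
    -- write both sides as polynomials in the atoms
    have eL : (σ 0 q₁ : ℝ) ^ B * l2Sq N β *
        (ω₀ * (C₃ * (2 * N / r) * ((2 * lg) ^ B₃ * (σ 0 r : ℝ) ^ B₃) / z * L4b +
            Tc * ((2 * M + M / 2) / ((q₁ : ℝ) * r) + 1)) +
          (σ 0 q₁ : ℝ) * (C₃ * (2 * N / (Q₀ * r)) *
            ((σ 0 q₁ : ℝ) ^ B₃ * (σ 0 r : ℝ) ^ B₃ * lg ^ B₃) * L4b +
            Tc * ((2 * M + M / 2) / ((q₁ : ℝ) * r) + 1))) =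
        l2Sq N β *
          ((ω₀ * C₃ * C₄ * (5 * M * N) * (2 * lg) ^ B₃ * ℓ ^ B₄ / z) *
              (((σ 0 q₁ : ℝ) ^ B * (σ 0 q₁ : ℝ) ^ B₄) / q₁) *
              (((σ 0 r : ℝ) ^ B₃ * (σ 0 r : ℝ) ^ B₄) * (1 / ((r : ℝ) * r))) +
            (C₃ * C₄ * (5 * M * N) * lg ^ B₃ * ℓ ^ B₄ / Q₀) *
              (((σ 0 q₁ : ℝ) * (σ 0 q₁ : ℝ) ^ B * (σ 0 q₁ : ℝ) ^ B₃ * (σ 0 q₁ : ℝ) ^ B₄) / q₁) *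
              (((σ 0 r : ℝ) ^ B₃ * (σ 0 r : ℝ) ^ B₄) * (1 / ((r : ℝ) * r))) +
            (ω₀ * (σ 0 q₁ : ℝ) ^ B + (σ 0 q₁ : ℝ) * (σ 0 q₁ : ℝ) ^ B) * Tc *
              (5 * M / 2 * (1 / (q₁ : ℝ)) * (1 / (r : ℝ)) + 1)) := by
      rw [hL4b]
      field_simp
      ring
    rw [eL, hP4]
    have hKA : 0 ≤ ω₀ * C₃ * C₄ * (5 * M * N) * (2 * lg) ^ B₃ * ℓ ^ B₄ / z := by positivity
    have hKC : 0 ≤ C₃ * C₄ * (5 * M * N) * lg ^ B₃ * ℓ ^ B₄ / Q₀ := by positivity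
    refine mul_le_mul_of_nonneg_left ?_ hl
    have hRr : (σ 0 r : ℝ) ^ B₃ * (σ 0 r : ℝ) ^ B₄ * (1 / ((r : ℝ) * r)) ≤
        (σ 0 r : ℝ) ^ k₂ / (R * r) := by
      rw [div_eq_mul_one_div _ (R * r)]
      exact mul_le_mul hP2 hrr (by positivity) (by positivity)
    rw [hP4] at hP3
    gcongr


/-- `∑_r ∑_q c F(q) G(r) = c (∑_q F)(∑_r G)`. [folklore] -/
theorem sum_sum_const_mul {ι κ : Type*} (s : Finset ι) (t : Finset κ) (c : ℝ) (F : κ → ℝ)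
    (G : ι → ℝ) : ∑ r ∈ s, ∑ q ∈ t, c * F q * G r = c * (∑ q ∈ t, F q) * ∑ r ∈ s, G r := by
  rw [Finset.mul_sum]
  refine Finset.sum_congr rfl fun r _ => ?_
  rw [← Finset.sum_mul, ← Finset.mul_sum]

/-- `∑_{r∼R} τ(r)^k/(R r) ≤ S/R` from `∑_{m ≤ 2R} τ(m)^k/m ≤ S` (`R > 0`). [folklore] -/
theorem sum_dyadic_sigma_pow_div_R_le_of {R S : ℝ} (hR : 0 < R) {k : ℕ}
    (hS : ∑ m ∈ Icc 1 ⌊2 * R⌋₊, (σ 0 m : ℝ) ^ k / m ≤ S) :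
    ∑ r ∈ dyadic R, (σ 0 r : ℝ) ^ k / (R * r) ≤ S / R := by
  have h1 := sum_dyadic_sigma_pow_div_le_of hR.le hS
  have e : ∀ r : ℕ, (σ 0 r : ℝ) ^ k / (R * r) = R⁻¹ * ((σ 0 r : ℝ) ^ k / r) := by
    intro r; rw [mul_comm R, ← div_div, div_eq_mul_inv _ R, mul_comm]
  simp only [e, ← Finset.mul_sum]
  rw [div_eq_mul_inv S R, mul_comm S]
  exact mul_le_mul_of_nonneg_left h1 (by positivity)

/-- **BFI (6.3)–(6.4) averaged: `𝒮₁` off the main range** (p. 220: "`𝒮₁(q₀ > Q₀) ≪ ‖β‖²x(Q₀R)⁻¹ℒ^B`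
… (6.3)"; "`𝒮₁(n₀ > N₀) ≪ ‖β‖²x(N₀R)⁻¹ℒ^B` (6.4)").  The bound of `BFI.abs_dS1n_le` (`Y = M/2`, all
its hypotheses kept verbatim) summed over `r ∼ R`, `q₁ ∼ Q`: with `ℓ = log(5M/2)`,
`K_A = ω₀C₃C₄·5MN·(2lg)^{B₃}ℓ^{B₄}/z`, `K_C = C₃C₄·5MN·lg^{B₃}ℓ^{B₄}/Q₀`, `T_c = T(2N/(P₀R)+1)`,
bounds `S_{Q,1} ≥ ∑_{m≤2Q}τ^{k₁}/m`, `S_{Q,3}`, `S_R` for natural `k₁ ≥ B+B₄`, `k₂ ≥ B₃+B₄`,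
`k₃ ≥ 1+B+B₃+B₄`, and the divisor bound (`ν(B+1) ≤ ε₁/4 ≤ 1`, `Q ≤ 2x`):
`|𝒮₁ⁿ| ≤ ‖β‖² (K_A S_{Q,1} S_R/R + K_C S_{Q,3} S_R/R + (ω₀C₀^B + C₀^{B+1}) T_c · 16x^{ε₁/4} · (10M + Q(2R+1)))`.
[cite: BombieriFriedlanderIwaniecActa1986, §6 (6.3)–(6.4) p. 220] -/
theorem abs_dS1n_le_avg {C₀ ν : ℝ} (hC₀ : 1 ≤ C₀) (hν : 0 ≤ ν)
    (hτ : ∀ n : ℕ, n ≠ 0 → ((σ 0 n : ℕ) : ℝ) ≤ C₀ * (n : ℝ) ^ ν) {a : ℤ}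
    {M N Q R Q₀ B z x ε₁ : ℝ} (hM1 : 1 ≤ M) (haM : (|a| : ℝ) < M - M / 2) (hN : 1 ≤ N)
    (hQ : 1 / 2 ≤ Q) (hR : 1 / 2 ≤ R) (hQx : Q ≤ 2 * x) (hx : 1 ≤ x) (hQ₀ : 0 < Q₀) (hB : 0 ≤ B)
    (hνB : ν * (B + 1) ≤ ε₁ / 4) (hε₁ : ε₁ ≤ 4)
    {γ : ℕ → ℝ} (hγ : ∀ q, |γ q| ≤ (σ 0 q : ℝ) ^ B) (β : ℕ → ℝ) (hz : 0 < z)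
    (hsift : IsSifted (dyadic N) z β)
    {C₃ B₃ X₀ ε₃ C₄ B₄ X₀' ε₃' P₀ T lg ω₀ : ℝ} (hC₃ : 0 ≤ C₃) (hB₃ : 0 ≤ B₃) (hC₄ : 0 ≤ C₄)
    (hB₄ : 0 ≤ B₄) (hP₀ : 0 < P₀) (hT : 0 ≤ T) (hlg0 : 0 ≤ lg) (hω₀ : 0 ≤ ω₀)
    (hL3 : ∀ X : ℝ, X₀ ≤ X → ∀ k : ℕ, 0 < k → (k : ℝ) ≤ X ^ (1 - ε₃) → ∀ l : ZMod k,
      ∑ v ∈ l3Set a X k l, l3Term a (B + 1) v ≤ C₃ * (X / k) * ((σ 0 k : ℝ) * Real.log X) ^ B₃)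
    (hL3' : ∀ X : ℝ, X₀' ≤ X → ∀ k : ℕ, 0 < k → (k : ℝ) ≤ X ^ (1 - ε₃') → ∀ l : ZMod k,
      ∑ v ∈ l3Set a X k l, l3Term a B₃ v ≤ C₄ * (X / k) * ((σ 0 k : ℝ) * Real.log X) ^ B₄)
    (hX₀ : X₀ ≤ 2 * (M - M / 2) * N) (hX₀' : X₀' ≤ 2 * M + M / 2)
    (hlev : ∀ m : ℕ, M - M / 2 < (m : ℝ) → (m : ℝ) ≤ 2 * M + M / 2 → ∀ t : ℕ,
      (t : ℝ) ≤ 2 * P₀ * R → ((m * t : ℕ) : ℝ) ≤ (2 * m * N) ^ (1 - ε₃))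
    (hlev' : ∀ k : ℕ, (k : ℝ) ≤ 4 * Q * R → (k : ℝ) ≤ (2 * M + M / 2) ^ (1 - ε₃'))
    (hTv : ∀ m : ℕ, (m : ℝ) ≤ 2 * M + M / 2 → ∀ n ∈ dyadic N,
      (σ 0 (((m * n : ℕ) : ℤ) - a).toNat : ℝ) ^ (B + 1) ≤ T)
    (hlg : ∀ m : ℕ, M - M / 2 < (m : ℝ) → (m : ℝ) ≤ 2 * M + M / 2 →
      0 ≤ Real.log (2 * m * N) ∧ Real.log (2 * m * N) ≤ lg)
    (hω : ∀ n ∈ dyadic N, (n.primeFactors.card : ℝ) ≤ ω₀)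
    {k₁ k₂ k₃ : ℕ} (hk₁ : B + B₄ ≤ k₁) (hk₂ : B₃ + B₄ ≤ k₂) (hk₃ : 1 + B + B₃ + B₄ ≤ k₃)
    {SQ1 SQ3 SR : ℝ}
    (hSQ1 : ∑ m ∈ Icc 1 ⌊2 * Q⌋₊, (σ 0 m : ℝ) ^ k₁ / m ≤ SQ1)
    (hSQ3 : ∑ m ∈ Icc 1 ⌊2 * Q⌋₊, (σ 0 m : ℝ) ^ k₃ / m ≤ SQ3)
    (hSR : ∑ m ∈ Icc 1 ⌊2 * R⌋₊, (σ 0 m : ℝ) ^ k₂ / m ≤ SR) :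
    |dS1n a (mRange M (M / 2)) N Q R Q₀ (fun m => bump M (M / 2) m) β γ| ≤
      l2Sq N β *
        ((ω₀ * C₃ * C₄ * (5 * M * N) * (2 * lg) ^ B₃ * Real.log (2 * M + M / 2) ^ B₄ / z) *
            SQ1 * SR / R +
          (C₃ * C₄ * (5 * M * N) * lg ^ B₃ * Real.log (2 * M + M / 2) ^ B₄ / Q₀) *
            SQ3 * SR / R +
          (ω₀ * C₀ ^ B + C₀ ^ (B + 1)) * (T * (2 * N / (P₀ * R) + 1)) * (16 * x ^ (ε₁ / 4)) *
            (10 * M + Q * (2 * R + 1))) := by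
  have hY : 0 < M / 2 := by linarith
  have hYM : M / 2 ≤ M := by linarith
  have hQ0 : 0 < Q := by linarith
  have hR0 : 0 < R := by linarith
  have hN0 : (0 : ℝ) ≤ N := by linarith
  have hM0 : (0 : ℝ) ≤ M := by linarith
  have hl := l2Sq_nonneg N β
  have hraw := abs_dS1n_le (Y := M / 2) hY hYM hM1 haM hN hQ0 hR0 hQ₀ hB hγ β hz hsift hC₃ hB₃
    hC₄ hP₀ hT hω₀ hL3 hL3' hX₀ hX₀' hlev hlev' hTv hlg hω
  refine hraw.trans ?_
  -- abbreviations
  set ℓ : ℝ := Real.log (2 * M + M / 2) with hℓ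
  set KA : ℝ := ω₀ * C₃ * C₄ * (5 * M * N) * (2 * lg) ^ B₃ * ℓ ^ B₄ / z with hKA
  set KC : ℝ := C₃ * C₄ * (5 * M * N) * lg ^ B₃ * ℓ ^ B₄ / Q₀ with hKC
  set Tc : ℝ := T * (2 * N / (P₀ * R) + 1) with hTc
  have hℓ0 : 0 ≤ ℓ := Real.log_nonneg (by linarith)
  have hKA0 : 0 ≤ KA := by positivity
  have hKC0 : 0 ≤ KC := by positivity
  have hTc0 : 0 ≤ Tc := by positivity
  set f₁ : ℕ → ℝ := fun q => (σ 0 q : ℝ) ^ k₁ / q with hf₁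
  set f₃ : ℕ → ℝ := fun q => (σ 0 q : ℝ) ^ k₃ / q with hf₃
  set g : ℕ → ℝ := fun r => (σ 0 r : ℝ) ^ k₂ / (R * r) with hg
  set W : ℕ → ℝ := fun q => ω₀ * (σ 0 q : ℝ) ^ B + (σ 0 q : ℝ) ^ (B + 1) with hW
  -- termwise
  have hterm : ∀ r ∈ dyadic R, ∀ q₁ ∈ dyadic Q,
      |γ q₁| * l2Sq N β *
        (ω₀ * (C₃ * (2 * N / r) * (2 * (σ 0 r : ℝ) * lg) ^ B₃ / z *
            (C₄ * ((2 * M + M / 2) / ((q₁ * r : ℕ) : ℝ)) *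
              ((σ 0 (q₁ * r) : ℝ) * Real.log (2 * M + M / 2)) ^ B₄) +
            T * (2 * N / (P₀ * R) + 1) * ((2 * M + M / 2) / ((q₁ * r : ℕ) : ℝ) + 1)) +
          (σ 0 q₁ : ℝ) * (C₃ * (2 * N / (Q₀ * r)) * ((σ 0 q₁ : ℝ) * (σ 0 r : ℝ) * lg) ^ B₃ *
            (C₄ * ((2 * M + M / 2) / ((q₁ * r : ℕ) : ℝ)) *
              ((σ 0 (q₁ * r) : ℝ) * Real.log (2 * M + M / 2)) ^ B₄) +
            T * (2 * N / (P₀ * R) + 1) * ((2 * M + M / 2) / ((q₁ * r : ℕ) : ℝ) + 1))) ≤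
      l2Sq N β * KA * f₁ q₁ * g r + l2Sq N β * KC * f₃ q₁ * g r +
        l2Sq N β * Tc * (5 * M / 2) * (W q₁ * (1 / (q₁ : ℝ))) * (1 / (r : ℝ)) +
        l2Sq N β * Tc * W q₁ * 1 := by
    intro r hr q₁ hq₁
    have h := dS1n_term_le hM1 hN0 hQ0 hR0 hQ₀ hz hC₃ hC₄ hB₄ hP₀ hT hlg0 hω₀ hγ β
      hk₁ hk₂ hk₃ hr hq₁
    refine h.trans (le_of_eq ?_)
    simp only [hKA, hKC, hTc, hf₁, hf₃, hg, hW, hℓ]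
    ring
  refine (Finset.sum_le_sum fun r hr => Finset.sum_le_sum fun q₁ hq₁ => hterm r hr q₁ hq₁).trans ?_
  rw [show (∑ r ∈ dyadic R, ∑ q₁ ∈ dyadic Q,
      (l2Sq N β * KA * f₁ q₁ * g r + l2Sq N β * KC * f₃ q₁ * g r +
        l2Sq N β * Tc * (5 * M / 2) * (W q₁ * (1 / (q₁ : ℝ))) * (1 / (r : ℝ)) +
        l2Sq N β * Tc * W q₁ * 1)) =
      l2Sq N β * KA * (∑ q ∈ dyadic Q, f₁ q) * (∑ r ∈ dyadic R, g r) +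
        l2Sq N β * KC * (∑ q ∈ dyadic Q, f₃ q) * (∑ r ∈ dyadic R, g r) +
        l2Sq N β * Tc * (5 * M / 2) * (∑ q ∈ dyadic Q, W q * (1 / (q : ℝ))) *
          (∑ r ∈ dyadic R, (1 / (r : ℝ))) +
        l2Sq N β * Tc * (∑ q ∈ dyadic Q, W q) * (∑ r ∈ dyadic R, (1 : ℝ)) by
    simp only [Finset.sum_add_distrib, sum_sum_const_mul]]
  -- the individual sums
  have hSf₁ : ∑ q ∈ dyadic Q, f₁ q ≤ SQ1 := sum_dyadic_sigma_pow_div_le_of hQ0.le hSQ1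
  have hSf₃ : ∑ q ∈ dyadic Q, f₃ q ≤ SQ3 := sum_dyadic_sigma_pow_div_le_of hQ0.le hSQ3
  have hSg : ∑ r ∈ dyadic R, g r ≤ SR / R := sum_dyadic_sigma_pow_div_R_le_of hR0 hSR
  have hSf₁0 : 0 ≤ ∑ q ∈ dyadic Q, f₁ q := Finset.sum_nonneg fun q _ => by positivity
  have hSf₃0 : 0 ≤ ∑ q ∈ dyadic Q, f₃ q := Finset.sum_nonneg fun q _ => by positivity
  have hSg0 : 0 ≤ ∑ r ∈ dyadic R, g r := Finset.sum_nonneg fun r _ => by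
    simp only [hg]; positivity
  have hSQ10 : 0 ≤ SQ1 := hSf₁0.trans hSf₁
  have hSQ30 : 0 ≤ SQ3 := hSf₃0.trans hSf₃
  have hB1 : 0 ≤ B + 1 := by linarith
  have hνB' : ν * B ≤ ε₁ / 4 := le_trans (by nlinarith) hνB
  have hWq : ∑ q ∈ dyadic Q, W q * (1 / (q : ℝ)) ≤
      ω₀ * (16 * C₀ ^ B * x ^ (ε₁ / 4)) + 16 * C₀ ^ (B + 1) * x ^ (ε₁ / 4) := by
    have h1 := sum_dyadic_sigma_rpow_div_le_x hC₀ hν hτ hQ hQx hx hB hνB' hε₁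
    have h2 := sum_dyadic_sigma_rpow_div_le_x hC₀ hν hτ hQ hQx hx hB1 hνB hε₁
    have e : ∀ q : ℕ, W q * (1 / (q : ℝ)) =
        ω₀ * ((σ 0 q : ℝ) ^ B / q) + (σ 0 q : ℝ) ^ (B + 1) / q := by
      intro q; simp only [hW]; ring
    simp only [e, Finset.sum_add_distrib, ← Finset.mul_sum]
    exact add_le_add (mul_le_mul_of_nonneg_left h1 hω₀) h2
  have hWs : ∑ q ∈ dyadic Q, W q ≤
      ω₀ * (16 * C₀ ^ B * Q * x ^ (ε₁ / 4)) + 16 * C₀ ^ (B + 1) * Q * x ^ (ε₁ / 4) := by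
    have h1 := sum_dyadic_sigma_rpow_le_x hC₀ hν hτ hQ hQx hx hB hνB' hε₁
    have h2 := sum_dyadic_sigma_rpow_le_x hC₀ hν hτ hQ hQx hx hB1 hνB hε₁
    simp only [hW, Finset.sum_add_distrib, ← Finset.mul_sum]
    exact add_le_add (mul_le_mul_of_nonneg_left h1 hω₀) h2
  have hWq0 : 0 ≤ ∑ q ∈ dyadic Q, W q * (1 / (q : ℝ)) := Finset.sum_nonneg fun q _ => by
    simp only [hW]; positivity
  have hWs0 : 0 ≤ ∑ q ∈ dyadic Q, W q := Finset.sum_nonneg fun q _ => by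
    simp only [hW]; positivity
  have hinv := sum_dyadic_inv_le hR
  have hcard : ∑ r ∈ dyadic R, (1 : ℝ) ≤ 2 * R + 1 := by
    rw [Finset.sum_const, nsmul_eq_mul, mul_one]; exact card_dyadic_le hR0.le
  have hx0 : 0 < x := by linarith
  have hSinv0 : 0 ≤ ∑ r ∈ dyadic R, (1 / (r : ℝ)) := Finset.sum_nonneg fun r _ => by positivity
  have hS10 : 0 ≤ ∑ r ∈ dyadic R, (1 : ℝ) := Finset.sum_nonneg fun r _ => zero_le_one
  have hC₀0 : (0 : ℝ) ≤ C₀ := le_trans zero_le_one hC₀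
  have hxe0 : 0 ≤ x ^ (ε₁ / 4) := Real.rpow_nonneg hx0.le _
  have hb1 : 0 ≤ ω₀ * (16 * C₀ ^ B * x ^ (ε₁ / 4)) + 16 * C₀ ^ (B + 1) * x ^ (ε₁ / 4) :=
    add_nonneg (mul_nonneg hω₀ (mul_nonneg (mul_nonneg (by norm_num) (Real.rpow_nonneg hC₀0 _)) hxe0))
      (mul_nonneg (mul_nonneg (by norm_num) (Real.rpow_nonneg hC₀0 _)) hxe0)
  have hb2 : 0 ≤ ω₀ * (16 * C₀ ^ B * Q * x ^ (ε₁ / 4)) + 16 * C₀ ^ (B + 1) * Q * x ^ (ε₁ / 4) :=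
    add_nonneg (mul_nonneg hω₀ (mul_nonneg (mul_nonneg (mul_nonneg (by norm_num)
      (Real.rpow_nonneg hC₀0 _)) hQ0.le) hxe0))
      (mul_nonneg (mul_nonneg (mul_nonneg (by norm_num) (Real.rpow_nonneg hC₀0 _)) hQ0.le) hxe0)
  have hlKA : 0 ≤ l2Sq N β * KA := mul_nonneg hl hKA0
  have hlKC : 0 ≤ l2Sq N β * KC := mul_nonneg hl hKC0
  have hlTc : 0 ≤ l2Sq N β * Tc := mul_nonneg hl hTc0
  have hlTcM : 0 ≤ l2Sq N β * Tc * (5 * M / 2) := mul_nonneg hlTc (by linarith)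
  have hT1 : l2Sq N β * KA * (∑ q ∈ dyadic Q, f₁ q) * (∑ r ∈ dyadic R, g r) ≤
      l2Sq N β * KA * SQ1 * (SR / R) :=
    mul_le_mul (mul_le_mul_of_nonneg_left hSf₁ hlKA) hSg hSg0 (mul_nonneg hlKA hSQ10)
  have hT2 : l2Sq N β * KC * (∑ q ∈ dyadic Q, f₃ q) * (∑ r ∈ dyadic R, g r) ≤
      l2Sq N β * KC * SQ3 * (SR / R) :=
    mul_le_mul (mul_le_mul_of_nonneg_left hSf₃ hlKC) hSg hSg0 (mul_nonneg hlKC hSQ30)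
  have hT3 : l2Sq N β * Tc * (5 * M / 2) * (∑ q ∈ dyadic Q, W q * (1 / (q : ℝ))) *
        (∑ r ∈ dyadic R, (1 / (r : ℝ))) ≤
      l2Sq N β * Tc * (5 * M / 2) *
        (ω₀ * (16 * C₀ ^ B * x ^ (ε₁ / 4)) + 16 * C₀ ^ (B + 1) * x ^ (ε₁ / 4)) * 4 :=
    mul_le_mul (mul_le_mul_of_nonneg_left hWq hlTcM) hinv hSinv0 (mul_nonneg hlTcM hb1)
  have hT4 : l2Sq N β * Tc * (∑ q ∈ dyadic Q, W q) * (∑ r ∈ dyadic R, (1 : ℝ)) ≤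
      l2Sq N β * Tc *
        (ω₀ * (16 * C₀ ^ B * Q * x ^ (ε₁ / 4)) + 16 * C₀ ^ (B + 1) * Q * x ^ (ε₁ / 4)) *
        (2 * R + 1) :=
    mul_le_mul (mul_le_mul_of_nonneg_left hWs hlTc) hcard hS10 (mul_nonneg hlTc hb2)
  refine (add_le_add (add_le_add (add_le_add hT1 hT2) hT3) hT4).trans (le_of_eq ?_)
  simp only [hKA, hKC, hTc, hℓ]
  field_simp
  ring


end BFI

end Literature.NumberTheory.Sieve
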